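import Literature.MathematicalPhysics.QuantumFieldTheory.ConformalBootstrap3D.PointKernelK34L505Data
import Literature.MathematicalPhysics.QuantumFieldTheory.ConformalBootstrap3D.PointKernelK34L505Segs
import Literature.MathematicalPhysics.QuantumFieldTheory.ConformalBootstrap3D.PointKernelParts

/-!
# K34L505 certificate, kernel part file P23: one-cell head segments 95 in level ranges

The head cells whose kernel evaluation exceeds one `decide` are one-cell segments of `hsegsK34L505`; each is
checked by `PCert.hPartSideOK` (side conditions) and `PCert.hPartOK` per level range `[n_lo, n_lo + count)`
against an integer claim, the claims summing to `≥ 0` (`PointKernel.partsOK`); soundness is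
`PCert.hParts_sound` (`PointKernelParts`).  The part files are mutually independent (each imports only
the data file); the ranges of one cell may span several of them, and the per-cell conclusions
`hparts_i` / `hcell_i` of those cells are assembled in `PointKernelK34L505.lean`.
Estimated kernel time 225 s.
-/

set_option maxRecDepth 100000
set_option maxHeartbeats 0

namespace Literature.MathematicalPhysics.QuantumFieldTheory.ConformalBootstrap3D.PointKernelK34L505

open Literature.MathematicalPhysics.QuantumFieldTheory.ConformalBootstrap3D.PointKernel

/-- levels `[55, 60)` of segment 95: partial lower sum `≥` claim. [folklore] -/
theorem part_95_5 : certK34L505.hPartOK (PCert.segAt hsegsK34L505 95) JHK34L505 55 5 (560544387651575775309960979869081291) = true := by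
  decide +kernel

/-- levels `[60, 64)` of segment 95: partial lower sum `≥` claim. [folklore] -/
theorem part_95_6 : certK34L505.hPartOK (PCert.segAt hsegsK34L505 95) JHK34L505 60 4 (267509811026338807918856815584918632) = true := by
  decide +kernel

/-- levels `[64, 68)` of segment 95: partial lower sum `≥` claim. [folklore] -/
theorem part_95_7 : certK34L505.hPartOK (PCert.segAt hsegsK34L505 95) JHK34L505 64 4 (169039251015207744214379368368777603) = true := by
  decide +kernel

/-- levels `[68, 71)` of segment 95: partial lower sum `≥` claim. [folklore] -/
theorem part_95_8 : certK34L505.hPartOK (PCert.segAt hsegsK34L505 95) JHK34L505 68 3 (82741133228087758873288552350426541) = true := by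
  decide +kernel

end Literature.MathematicalPhysics.QuantumFieldTheory.ConformalBootstrap3D.PointKernelK34L505
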